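import Literature.Analysis.Complex.PlaneCurveSheets
import Literature.Analysis.Complex.HolomorphicAreaMultiplicity
import Mathlib.Algebra.Order.Chebyshev
import HarnessLib

/-!
# Sheet sums over an analytic curve in `ℂ²` and the local area bound

Continuation of `Literature/Analysis/Complex/PlaneCurveSheets.lean`. For a closed set
`Z ⊆ ℂ × ℂ` which at EVERY point is the zero set of a holomorphic function with non-trivial
slices in BOTH variables (`PlaneCurve.BiWeierstrass`: an analytic curve containing no vertical
and no horizontal line germ — in a `z`-box a branched cover of the `z`-disc, in a `w`-box of the
`w`-disc), and an integrand `g (q, σ)` of a point `q` and a slope `σ`, the **sheet sum**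
`PlaneCurve.sheetSum Z g z = Σ_{w : (z, w) ∈ Z} g ((z, w), slope Z (z, w))` is the density, on
the `z`-axis, of "`g` integrated over `Z`": over the good set of a `z`-box it is the finite sum
of `g` over the holomorphic sheets with their derivatives as slopes (`ZBox.sheetSum_eq_sum_sheets`),
hence continuous there (`ZBox.continuousOn_sheetSum`) and a.e.-strongly measurable
(`ZBox.aestronglyMeasurable_sheetSum`).

The main estimate is the **local area bound** `ZBox.lintegral_fibre_slope_sq_lt_top`:
`∫_{base} Σ_{w ∈ fibre z, (z,w) ∈ K} |slope Z (z, w)|² dz < ∞` for compact `K` inside the box —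
the `z`-projection form of Lelong's theorem that an analytic curve has locally finite area
(Chirka, *Complex Analytic Sets* (1989), §14.1; Griffiths–Harris, Ch. 0 §2, "the volume of an
analytic variety is locally finite"): on a holomorphic sheet `w = β(z)` the integrand `|β'|²` is
the Jacobian of `β`, so by the area formula with multiplicity
(`Literature.Analysis.Complex.AreaMultiplicity.tsum_lintegral_norm_deriv_sq_le`) the integral is
the area, counted with multiplicity, swept by the sheets in the `w`-plane, and the multiplicity is
bounded by the degree of a `w`-box. Consequences: integrability of sheet sums of integrands of
quadratic growth in the slope and square-integrability for linear growth
(`ZBox.integrable_sheetSum`, `ZBox.integrable_norm_sheetSum_sq`), the inputs of the Stokes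
theorem for the sheet-sum current (`PlaneCurveCurrent.lean`).

## References

* E. M. Chirka, *Complex Analytic Sets*, Kluwer 1989, §1.3, §2.3, §14.1 (Lelong's theorem).
  [Chirka1989]
* P. Griffiths, J. Harris, *Principles of Algebraic Geometry*, Wiley 1978, Ch. 0 §2
  (Stokes' theorem and finite volume for analytic varieties). [GriffithsHarrisPrinciples1978]
* H. Federer, *Geometric Measure Theory*, Springer 1969, Thm. 3.2.3. [Federer1969]
-/

noncomputable section

open Set Filter Metric Topology Complex MeasureTheory
open scoped ENNReal NNReal
open Literature.Analysis.Complex.SCV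

namespace Literature.Analysis.Complex

namespace PlaneCurve

variable {Z : Set (ℂ × ℂ)}

/-! ### Bi-Weierstrass curves and their fibres -/

/-- A **bi-Weierstrass curve**: a closed `Z ⊆ ℂ × ℂ` which near each of its points is the zero
set of a holomorphic function with non-identically-vanishing slices in the second variable AND
in the first variable (no vertical and no horizontal complex line germ lies on `Z`).
[cite: Chirka1989, §1.1] -/
structure BiWeierstrass (Z : Set (ℂ × ℂ)) : Prop where
  isClosed : IsClosed Z
  weierstrassAt : ∀ p ∈ Z, IsWeierstrassAt Z p
  coWeierstrassAt : ∀ p ∈ Z, IsWeierstrassAt (Prod.swap ⁻¹' Z) p.swap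

/-- The **fibre** of `Z` over `z`: `{w : (z, w) ∈ Z}`. [folklore] -/
def fibreSet (Z : Set (ℂ × ℂ)) (z : ℂ) : Set ℂ := {w | (z, w) ∈ Z}

/-- Membership in the fibre (definitional). [folklore] -/
@[simp] theorem mem_fibreSet {z w : ℂ} : w ∈ fibreSet Z z ↔ (z, w) ∈ Z := Iff.rfl

/-- **Points of a Weierstrass curve are isolated in their vertical slice.** [cite: Chirka1989, §1.1] -/
theorem IsWeierstrassAt.eventually_notMem {p : ℂ × ℂ} (h : IsWeierstrassAt Z p) :
    ∀ᶠ w in 𝓝[≠] p.2, (p.1, w) ∉ Z := by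
  obtain ⟨U, hUo, hpU, f, hf, hZU, hne⟩ := h
  have hslice : ∀ᶠ w in 𝓝 p.2, (p.1, w) ∈ U :=
    (Continuous.prodMk_right p.1).continuousAt.preimage_mem_nhds (hUo.mem_nhds (by simpa using hpU))
  have han : AnalyticAt ℂ (fun w => f (p.1, w)) p.2 := by
    have hd : DifferentiableOn ℂ (fun w => f (p.1, w)) ((fun w => (p.1, w)) ⁻¹' U) :=
      hf.comp (by fun_prop) fun w hw => hw
    exact hd.analyticAt ((hUo.preimage (Continuous.prodMk_right p.1)).mem_nhds (by simpa using hpU))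
  have hne' := han.eventually_eq_zero_or_eventually_ne_zero.resolve_left hne
  filter_upwards [hne', nhdsWithin_le_nhds hslice] with w hw hwU hwZ
  have : (p.1, w) ∈ Z ∩ U := ⟨hwZ, hwU⟩
  rw [hZU] at this
  exact hw this.2

/-- **Compact pieces of fibres are finite**: if `Z` is Weierstrass at each of its points and
closed, then for compact `K` the set of `w` with `(z, w) ∈ Z ∩ K` is finite (compact and
discrete). [cite: Chirka1989, §1.1] -/
theorem finite_fibreSet_inter (hZc : IsClosed Z) (hZw : ∀ p ∈ Z, IsWeierstrassAt Z p) {K : Set (ℂ × ℂ)}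
    (hK : IsCompact K) (z : ℂ) : {w | (z, w) ∈ Z ∧ (z, w) ∈ K}.Finite := by
  have hcl : IsClosed {w | (z, w) ∈ Z ∧ (z, w) ∈ K} :=
    (hZc.inter hK.isClosed).preimage (Continuous.prodMk_right z)
  have hbdd : IsCompact {w | (z, w) ∈ Z ∧ (z, w) ∈ K} := by
    refine (hK.image continuous_snd).of_isClosed_subset hcl ?_
    rintro w ⟨-, hwK⟩
    exact ⟨(z, w), hwK, rfl⟩
  refine hbdd.finite ?_
  rw [isDiscrete_iff_nhdsNE]
  rintro w ⟨hwZ, -⟩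
  have hev := (hZw (z, w) hwZ).eventually_notMem
  rw [Filter.inf_principal_eq_bot]
  exact mem_of_superset hev fun w' hw' hw'S => hw' hw'S.1

/-- For a bi-Weierstrass curve, compact pieces of fibres are finite. [cite: Chirka1989, §1.1] -/
theorem BiWeierstrass.finite_fibreSet_inter (hZ : BiWeierstrass Z) {K : Set (ℂ × ℂ)}
    (hK : IsCompact K) (z : ℂ) : {w | (z, w) ∈ Z ∧ (z, w) ∈ K}.Finite :=
  PlaneCurve.finite_fibreSet_inter hZ.isClosed hZ.weierstrassAt hK z

/-! ### Sheet sums -/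

section SheetSum

variable {F : Type*} [AddCommMonoid F]

/-- The **sheet sum** of an integrand `g (q, σ)` (a point `q ∈ ℂ × ℂ` and a slope `σ ∈ ℂ`) over
the fibre of `Z` above `z`: `Σ_{w : (z, w) ∈ Z} g ((z, w), slope Z (z, w))` (a `finsum`; it is a
genuine finite sum as soon as `g` is supported, in `q`, in a compact set, by
`finite_fibreSet_inter`). For the `2`-form integrand `g (q, σ) = θ_q ((1, σ), (i, iσ))` this is
the density on the `z`-axis of `∫_Z θ`. [cite: GriffithsHarrisPrinciples1978, Ch. 0 §2] -/
def sheetSum (Z : Set (ℂ × ℂ)) (g : ℂ × ℂ → ℂ → F) (z : ℂ) : F :=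
  ∑ᶠ w ∈ fibreSet Z z, g (z, w) (slope Z (z, w))

/-- `g` is **supported in `K`** (in the point variable, uniformly in the slope). [folklore] -/
def SuppIn (g : ℂ × ℂ → ℂ → F) (K : Set (ℂ × ℂ)) : Prop :=
  ∀ q, q ∉ K → ∀ σ, g q σ = 0

omit [AddCommMonoid F] in
/-- Monotonicity of the support condition. [folklore] -/
theorem SuppIn.mono {g : ℂ × ℂ → ℂ → F} [AddCommMonoid F] {K K' : Set (ℂ × ℂ)}
    (h : SuppIn g K) (hKK' : K ⊆ K') : SuppIn g K' :=
  fun q hq σ => h q (fun hqK => hq (hKK' hqK)) σ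

/-- **Sheet sums of compactly supported integrands are finite sums** over the finite set
`{w : (z, w) ∈ Z ∩ K}`. [folklore] -/
theorem sheetSum_eq_sum_of_suppIn (hZ : BiWeierstrass Z) {g : ℂ × ℂ → ℂ → F} {K : Set (ℂ × ℂ)}
    (hK : IsCompact K) (hg : SuppIn g K) (z : ℂ) :
    sheetSum Z g z = ∑ w ∈ (hZ.finite_fibreSet_inter hK z).toFinset, g (z, w) (slope Z (z, w)) := by
  refine finsum_mem_eq_sum_of_subset _ ?_ ?_
  · intro w ⟨hwZ, hws⟩
    rw [Finite.coe_toFinset]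
    refine ⟨hwZ, ?_⟩
    by_contra hK'
    exact hws (hg _ hK' _)
  · intro w hw
    rw [Finite.coe_toFinset] at hw
    exact hw.1

/-- Additivity of the sheet sum in the integrand (compact supports). [folklore] -/
theorem sheetSum_add (hZ : BiWeierstrass Z) {g₁ g₂ : ℂ × ℂ → ℂ → F} {K : Set (ℂ × ℂ)}
    (hK : IsCompact K) (h₁ : SuppIn g₁ K) (h₂ : SuppIn g₂ K) (z : ℂ) :
    sheetSum Z (g₁ + g₂) z = sheetSum Z g₁ z + sheetSum Z g₂ z := by
  have h12 : SuppIn (g₁ + g₂) K := fun q hq σ => by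
    simp [h₁ q hq σ, h₂ q hq σ]
  rw [sheetSum_eq_sum_of_suppIn hZ hK h12, sheetSum_eq_sum_of_suppIn hZ hK h₁,
    sheetSum_eq_sum_of_suppIn hZ hK h₂, ← Finset.sum_add_distrib]
  rfl

/-- Finite additivity of the sheet sum in the integrand (compact supports). [folklore] -/
theorem sheetSum_finset_sum (hZ : BiWeierstrass Z) {ι : Type*} (t : Finset ι)
    {g : ι → ℂ × ℂ → ℂ → F} {K : Set (ℂ × ℂ)} (hK : IsCompact K) (h : ∀ i ∈ t, SuppIn (g i) K)
    (z : ℂ) : sheetSum Z (∑ i ∈ t, g i) z = ∑ i ∈ t, sheetSum Z (g i) z := by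
  classical
  induction t using Finset.induction_on with
  | empty =>
    simp only [Finset.sum_empty]
    exact finsum_mem_eq_zero_of_forall_eq_zero fun _ _ => rfl
  | insert a t hat ih =>
    rw [Finset.sum_insert hat, Finset.sum_insert hat,
      sheetSum_add hZ hK (h a (Finset.mem_insert_self a t)) ?_, ih fun i hi =>
        h i (Finset.mem_insert_of_mem hi)]
    intro q hq σ
    rw [Finset.sum_apply, Finset.sum_apply]
    exact Finset.sum_eq_zero fun i hi => h i (Finset.mem_insert_of_mem hi) q hq σ

end SheetSum

/-! ### Sheet sums of box-supported integrands -/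

namespace ZBox

variable (B : ZBox Z)

section Monoid

variable {F : Type*} [AddCommMonoid F] {g : ℂ × ℂ → ℂ → F}

/-- **Localisation**: for an integrand supported in the box, the sheet sum over a point of the
base disc is the sum over the fibre of the box. [folklore] -/
theorem sheetSum_eq_sum_fibre (hg : SuppIn g B.box) {z : ℂ} (hz : z ∈ B.base) :
    sheetSum Z g z = ∑ w ∈ B.fibre z, g (z, w) (slope Z (z, w)) := by
  refine finsum_mem_eq_sum_of_subset _ ?_ ?_
  · intro w ⟨hwZ, hws⟩
    rw [Finset.mem_coe, B.mem_fibre_iff hz]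
    refine ⟨?_, hwZ⟩
    by_contra hwr
    exact hws (hg (z, w) (fun hq => hwr hq.2) _)
  · intro w hw
    rw [Finset.mem_coe, B.mem_fibre_iff hz] at hw
    exact hw.2

/-- Off the base disc the sheet sum of a box-supported integrand vanishes. [folklore] -/
theorem sheetSum_eq_zero (hg : SuppIn g B.box) {z : ℂ} (hz : z ∉ B.base) : sheetSum Z g z = 0 :=
  finsum_mem_eq_zero_of_forall_eq_zero fun w _ => hg (z, w) (fun hq => hz hq.1) _

/-- **Sheet sums over the sheets**: on a sheet disc, the sheet sum is the sum of the integrand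
over the sheets, with the derivatives of the sheets as slopes. [cite: Chirka1989, §1.3] -/
theorem sheetSum_eq_sum_sheets (hg : SuppIn g B.box) {z₁ : ℂ} (S : B.Sheets z₁) {z : ℂ}
    (hz : z ∈ ball z₁ S.δ) :
    sheetSum Z g z = ∑ i, g (z, S.β i z) (deriv (S.β i) z) := by
  rw [B.sheetSum_eq_sum_fibre hg (S.ball_subset hz),
    S.sum_fibre_eq hz (fun w => g (z, w) (slope Z (z, w)))]
  exact Finset.sum_congr rfl fun i _ => by rw [S.slope_eq hz i]

end Monoid

section Normed

variable {F : Type*} [NormedAddCommGroup F] {g : ℂ × ℂ → ℂ → F}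

/-- **Continuity of sheet sums on the good set** (for a jointly continuous, box-supported
integrand): locally the sheet sum is a finite sum of continuous functions of `z`.
[cite: Chirka1989, §1.3] -/
theorem continuousOn_sheetSum (hg : SuppIn g B.box) (hgc : Continuous (Function.uncurry g)) :
    ContinuousOn (sheetSum Z g) B.good := by
  intro z₁ hz₁
  set S := B.sheets hz₁
  have hev : sheetSum Z g =ᶠ[𝓝 z₁] fun z => ∑ i, g (z, S.β i z) (deriv (S.β i) z) :=
    Filter.eventually_of_mem (ball_mem_nhds z₁ S.δ_pos) fun z hz => B.sheetSum_eq_sum_sheets hg S hz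
  have hcont : ContinuousOn (fun z => ∑ i, g (z, S.β i z) (deriv (S.β i) z)) (ball z₁ S.δ) := by
    refine continuousOn_finsetSum _ fun i _ => ?_
    have hβ : ContinuousOn (S.β i) (ball z₁ S.δ) := (S.differentiableOn i).continuousOn
    have hβ' : ContinuousOn (deriv (S.β i)) (ball z₁ S.δ) :=
      ((S.differentiableOn i).analyticOnNhd isOpen_ball).deriv.continuousOn
    exact hgc.comp_continuousOn ((continuousOn_id.prodMk hβ).prodMk hβ')
  exact ((hcont.continuousAt (ball_mem_nhds z₁ S.δ_pos)).congr hev.symm).continuousWithinAt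

/-- **Measurability of sheet sums** (box-supported continuous integrand): the sheet sum is
continuous on the good set, vanishes off the base disc, and the rest of the base disc is null.
[folklore] -/
theorem aestronglyMeasurable_sheetSum (hg : SuppIn g B.box) (hgc : Continuous (Function.uncurry g)) :
    AEStronglyMeasurable (sheetSum Z g) volume := by
  have h1 : AEStronglyMeasurable (B.good.indicator (sheetSum Z g)) volume :=
    (aestronglyMeasurable_indicator_iff B.isOpen_good.measurableSet).2
      ((B.continuousOn_sheetSum hg hgc).aestronglyMeasurable B.isOpen_good.measurableSet)
  refine h1.congr ?_
  rw [EventuallyEq, ae_iff]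
  refine measure_mono_null (fun z hz => ?_) B.volume_base_diff_good
  simp only [mem_setOf_eq] at hz
  by_cases hzg : z ∈ B.good
  · rw [indicator_of_mem hzg] at hz
    exact absurd rfl hz
  · rw [indicator_of_notMem hzg] at hz
    refine ⟨?_, hzg⟩
    by_contra hzb
    exact hz (B.sheetSum_eq_zero hg hzb).symm

end Normed

/-! ### A countable atlas of sheet discs over the good set -/

/-- The good set is non-empty. [folklore] -/
theorem good_nonempty : B.good.Nonempty := by
  obtain ⟨z, hz, hne⟩ := B.exists_disc_ne_zero
  exact ⟨z, hz, hne⟩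

/-- A **sheet atlas** of the box: a sequence of good points whose sheet discs cover the good set
(Lindelöf). [folklore] -/
structure Atlas (B : ZBox Z) where
  /-- the centres -/
  c : ℕ → ℂ
  mem_good : ∀ n, c n ∈ B.good
  cover : B.good ⊆ ⋃ n, ball (c n) (B.sheets (mem_good n)).δ

/-- Existence of a sheet atlas. [folklore] -/
theorem nonempty_atlas : Nonempty B.Atlas := by
  have hopen : ∀ x : B.good, IsOpen (ball (x : ℂ) (B.sheets x.2).δ) := fun x => isOpen_ball
  obtain ⟨T, hTc, hTU⟩ := TopologicalSpace.isOpen_iUnion_countable _ hopen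
  have hcov : ∀ z, z ∈ B.good → ∃ x ∈ T, z ∈ ball (x : ℂ) (B.sheets x.2).δ := by
    intro z hz
    have : z ∈ ⋃ x : B.good, ball (x : ℂ) (B.sheets x.2).δ :=
      mem_iUnion.2 ⟨⟨z, hz⟩, mem_ball_self (B.sheets hz).δ_pos⟩
    rw [← hTU] at this
    simpa only [mem_iUnion, exists_prop] using this
  obtain ⟨z₀, hz₀⟩ := B.good_nonempty
  obtain ⟨x₀, hx₀T, -⟩ := hcov z₀ hz₀
  obtain ⟨e, he⟩ := hTc.exists_eq_range ⟨x₀, hx₀T⟩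
  refine ⟨⟨fun n => (e n : ℂ), fun n => (e n).2, fun z hz => ?_⟩⟩
  obtain ⟨x, hxT, hzx⟩ := hcov z hz
  rw [he] at hxT
  obtain ⟨n, rfl⟩ := hxT
  exact mem_iUnion.2 ⟨n, hzx⟩

/-- A sheet atlas of the box (a choice). [folklore] -/
def atlas : B.Atlas := Classical.choice B.nonempty_atlas

namespace Atlas

variable {B} (A : B.Atlas)

/-- The sheets of the `n`-th disc. [folklore] -/
def S (n : ℕ) : B.Sheets (A.c n) := B.sheets (A.mem_good n)

/-- The `n`-th sheet disc. [folklore] -/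
def D (n : ℕ) : Set ℂ := ball (A.c n) (A.S n).δ

/-- The `n`-th piece: the sheet discs made disjoint. [folklore] -/
def Q (n : ℕ) : Set ℂ := disjointed A.D n

/-- The sheet discs are open. [folklore] -/
theorem isOpen_D (n : ℕ) : IsOpen (A.D n) := isOpen_ball

/-- The sheet discs lie in the base disc. [folklore] -/
theorem D_subset_base (n : ℕ) : A.D n ⊆ B.base := (A.S n).ball_subset

/-- The pieces lie in the sheet discs. [folklore] -/
theorem Q_subset_D (n : ℕ) : A.Q n ⊆ A.D n := disjointed_subset _ _

/-- The pieces are measurable. [folklore] -/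
theorem measurableSet_Q (n : ℕ) : MeasurableSet (A.Q n) :=
  MeasurableSet.disjointed (fun n => (A.isOpen_D n).measurableSet) n

/-- The pieces are pairwise disjoint. [folklore] -/
theorem disjoint_Q : Pairwise (Function.onFun Disjoint A.Q) := disjoint_disjointed _

/-- The pieces cover what the discs cover. [folklore] -/
theorem iUnion_Q : ⋃ n, A.Q n = ⋃ n, A.D n := iUnion_disjointed

/-- The good set is covered by the discs. [folklore] -/
theorem good_subset_iUnion_D : B.good ⊆ ⋃ n, A.D n := A.cover

/-- **The pieces carry the base disc up to a null set.** [folklore] -/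
theorem restrict_base_eq : volume.restrict B.base = volume.restrict (⋃ n, A.Q n) := by
  refine Measure.restrict_congr_set ?_
  rw [A.iUnion_Q]
  rw [MeasureTheory.ae_eq_set]
  constructor
  · refine measure_mono_null (fun z hz => ?_) B.volume_base_diff_good
    exact ⟨hz.1, fun hzg => hz.2 (A.good_subset_iUnion_D hzg)⟩
  · rw [sdiff_eq_empty.2 (iUnion_subset A.D_subset_base), measure_empty]

/-- **Fibre sums on a piece are sums over the sheets of its disc.** [folklore] -/
theorem sum_fibre_eq {M : Type*} [AddCommMonoid M] {n : ℕ} {z : ℂ} (hz : z ∈ A.Q n)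
    (φ : ℂ → M) : ∑ w ∈ B.fibre z, φ w = ∑ i, φ ((A.S n).β i z) :=
  (A.S n).sum_fibre_eq (A.Q_subset_D n hz) φ

/-- On a piece, slopes along the sheets are derivatives of the sheets. [folklore] -/
theorem slope_eq {n : ℕ} {z : ℂ} (hz : z ∈ A.Q n) (i : Fin (A.S n).s) :
    slope Z (z, (A.S n).β i z) = deriv ((A.S n).β i) z :=
  (A.S n).slope_eq (A.Q_subset_D n hz) i

/-- The index type of all sheets of the atlas. [folklore] -/
abbrev Idx : Type := Σ n : ℕ, Fin (A.S n).s

/-- The sheet with a given index. [folklore] -/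
def sheet (k : A.Idx) : ℂ → ℂ := (A.S k.1).β k.2

/-- **A point of a piece and a value determine the sheet**: sheets of one disc have distinct
values and the pieces are disjoint. [folklore] -/
theorem idx_eq_of_mem {k k' : A.Idx} {z : ℂ} (hk : z ∈ A.Q k.1) (hk' : z ∈ A.Q k'.1)
    (h : A.sheet k z = A.sheet k' z) : k = k' := by
  obtain ⟨n, i⟩ := k
  obtain ⟨n', i'⟩ := k'
  have hn : n = n' := by
    by_contra hne
    exact Set.disjoint_left.1 (A.disjoint_Q hne) hk hk'
  subst hn
  have hi : i = i' := by
    by_contra hne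
    exact (A.S n).injective z (A.Q_subset_D n hk) i i' hne h
  rw [hi]

end Atlas

/-! ### The local area bound -/

/-- The slope-squared density `q ↦ |slope Z q|²` as an `ℝ≥0∞`-valued function. [folklore] -/
def slopeSq (Z : Set (ℂ × ℂ)) (q : ℂ × ℂ) : ℝ≥0∞ := ENNReal.ofReal (‖slope Z q‖ ^ 2)

/-- **Measurability of fibre sums of the slope density** against an open set `N`: on the base
disc, `z ↦ Σ_{w ∈ fibre z} 1_N (z, w) |slope Z (z, w)|²` is a.e.-measurable (on each piece of
the atlas it is a finite sum of indicators of open sets times `|β'|²`). [folklore] -/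
theorem aemeasurable_sum_fibre_slopeSq {N : Set (ℂ × ℂ)} (hN : IsOpen N) :
    AEMeasurable (fun z => ∑ w ∈ B.fibre z, N.indicator (slopeSq Z) (z, w))
      (volume.restrict B.base) := by
  set A := B.atlas
  rw [A.restrict_base_eq, aemeasurable_iUnion_iff]
  intro n
  -- the measurable representative on the piece `Q n`
  set E : Fin (A.S n).s → Set ℂ := fun i => A.D n ∩ (fun z => (z, (A.S n).β i z)) ⁻¹' N with hE
  have hEo : ∀ i, IsOpen (E i) := fun i =>
    (continuousOn_id.prodMk ((A.S n).differentiableOn i).continuousOn).isOpen_inter_preimage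
      (A.isOpen_D n) hN
  set G : ℂ → ℝ≥0∞ := fun z => ∑ i, (E i).indicator
    (fun z => ENNReal.ofReal (‖deriv ((A.S n).β i) z‖ ^ 2)) z with hG
  have hGm : Measurable G := by
    refine Finset.measurable_sum _ fun i _ => Measurable.indicator ?_ (hEo i).measurableSet
    exact ((measurable_deriv _).norm.pow_const 2).ennreal_ofReal
  refine ⟨G, hGm, ?_⟩
  rw [EventuallyEq, ae_restrict_iff' (A.measurableSet_Q n)]
  refine Eventually.of_forall fun z hz => ?_
  rw [A.sum_fibre_eq hz]
  refine Finset.sum_congr rfl fun i _ => ?_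
  have hzD : z ∈ A.D n := A.Q_subset_D n hz
  by_cases hN' : (z, (A.S n).β i z) ∈ N
  · rw [indicator_of_mem hN', indicator_of_mem (show z ∈ E i from ⟨hzD, hN'⟩), slopeSq,
      A.slope_eq hz i]
  · rw [indicator_of_notMem hN', indicator_of_notMem (show z ∉ E i from fun h => hN' h.2)]

/-- **The local area bound against a `w`-box**: if `N = ball a r' × ball b ε'` is the window of a
`z`-box `B'` of the transposed curve `{(w, z) : (z, w) ∈ Z}` (centred at `b`, fibre disc
`ball a r'`), then `∫_{base} Σ_{w ∈ fibre z} 1_N (z,w) |slope Z (z,w)|² ≤ deg B' · area (ball b ε')`: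
the sheets sweep the `w`-disc at most `deg B'` times. [cite: Chirka1989, §14.1] -/
theorem lintegral_sum_fibre_slopeSq_le (B' : ZBox (Prod.swap ⁻¹' Z)) :
    ∫⁻ z in B.base, ∑ w ∈ B.fibre z,
        (ball B'.c B'.r ×ˢ B'.base).indicator (slopeSq Z) (z, w) ≤
      B'.deg * volume B'.base := by
  classical
  set A := B.atlas
  set N : Set (ℂ × ℂ) := ball B'.c B'.r ×ˢ B'.base with hNdef
  have hN : IsOpen N := isOpen_ball.prod isOpen_ball
  -- the pieces of the area formula, indexed by the sheets of the atlas
  set E : A.Idx → Set ℂ := fun k => A.D k.1 ∩ (fun z => (z, A.sheet k z)) ⁻¹' N with hE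
  have hEo : ∀ k, IsOpen (E k) := fun k =>
    (continuousOn_id.prodMk ((A.S k.1).differentiableOn k.2).continuousOn).isOpen_inter_preimage
      (A.isOpen_D k.1) hN
  set s : A.Idx → Set ℂ := fun k => E k ∩ A.Q k.1 with hs
  have hsm : ∀ k, MeasurableSet (s k) := fun k => (hEo k).measurableSet.inter (A.measurableSet_Q k.1)
  have hsD : ∀ k, s k ⊆ A.D k.1 := fun k z hz => hz.1.1
  -- Step 1: rewrite the integral as the sum over all sheets of `∫_{s k} |β'|²`
  have hstep1 : ∫⁻ z in B.base, ∑ w ∈ B.fibre z, N.indicator (slopeSq Z) (z, w) =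
      ∑' k : A.Idx, ∫⁻ z in s k, ENNReal.ofReal (‖deriv (A.sheet k) z‖ ^ 2) := by
    rw [A.restrict_base_eq, lintegral_iUnion A.measurableSet_Q A.disjoint_Q, ENNReal.tsum_sigma']
    refine tsum_congr fun n => ?_
    rw [tsum_fintype]
    have hpt : ∀ z ∈ A.Q n, ∑ w ∈ B.fibre z, N.indicator (slopeSq Z) (z, w) =
        ∑ i, (E ⟨n, i⟩).indicator (fun z => ENNReal.ofReal (‖deriv (A.sheet ⟨n, i⟩) z‖ ^ 2)) z := by
      intro z hz
      rw [A.sum_fibre_eq hz]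
      refine Finset.sum_congr rfl fun i _ => ?_
      have hzD : z ∈ A.D n := A.Q_subset_D n hz
      by_cases hN' : (z, (A.S n).β i z) ∈ N
      · rw [indicator_of_mem hN', indicator_of_mem (show z ∈ E ⟨n, i⟩ from ⟨hzD, hN'⟩), slopeSq,
          A.slope_eq hz i]
        rfl
      · rw [indicator_of_notMem hN', indicator_of_notMem (show z ∉ E ⟨n, i⟩ from fun h => hN' h.2)]
    rw [setLIntegral_congr_fun (A.measurableSet_Q n) hpt, lintegral_finsetSum]
    · refine Finset.sum_congr rfl fun i _ => ?_
      rw [lintegral_indicator (hEo _).measurableSet, Measure.restrict_restrict (hEo _).measurableSet]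
    · intro i _
      exact (((measurable_deriv _).norm.pow_const 2).ennreal_ofReal).indicator (hEo _).measurableSet
  rw [hstep1]
  -- Step 2: the area formula with multiplicity
  refine AreaMultiplicity.tsum_lintegral_norm_deriv_sq_le (V := fun k => A.D k.1)
    (fun k => A.isOpen_D k.1) (fun k => (A.S k.1).differentiableOn k.2) hsm hsD
    measurableSet_ball (fun k z hz => ?_) (d := B'.deg) fun w hw => ?_
  · -- the sheets map `s k` into the `w`-disc
    exact (mem_prod.1 hz.1.2).2
  · -- at most `deg B'` preimages: they lie in the fibre of the `w`-box over `w`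
    set t : Finset (A.Idx × ℂ) := (B'.fibre w).biUnion fun z =>
      if h : ∃ k, z ∈ s k ∧ A.sheet k z = w then {(h.choose, z)} else ∅ with ht
    refine ⟨t, ?_, fun k z hz hzw => ?_⟩
    · calc t.card ≤ ∑ z ∈ B'.fibre w, (if h : ∃ k, z ∈ s k ∧ A.sheet k z = w
            then ({(h.choose, z)} : Finset (A.Idx × ℂ)) else ∅).card := Finset.card_biUnion_le
        _ ≤ ∑ _z ∈ B'.fibre w, 1 := Finset.sum_le_sum fun z _ => by split_ifs <;> simp
        _ = (B'.fibre w).card := by simp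
        _ ≤ B'.deg := B'.card_fibre_le hw
    · have hex : ∃ k, z ∈ s k ∧ A.sheet k z = w := ⟨k, hz, hzw⟩
      have hk : hex.choose = k :=
        A.idx_eq_of_mem hex.choose_spec.1.2 hz.2 (by rw [hex.choose_spec.2, hzw])
      have hzN : (z, A.sheet k z) ∈ N := hz.1.2
      rw [hzw] at hzN
      have hzfib : z ∈ B'.fibre w := by
        rw [B'.mem_fibre_iff hw]
        exact ⟨(mem_prod.1 hzN).1, by
          change (z, w) ∈ Z
          rw [← hzw]
          exact (A.S k.1).mk_mem (hsD k hz) k.2⟩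
      refine Finset.mem_biUnion.2 ⟨z, hzfib, ?_⟩
      rw [dif_pos hex, hk]
      exact Finset.mem_singleton_self _

/-- **The local area bound (Lelong's theorem in the `z`-projection).** For a bi-Weierstrass
curve `Z`, a `z`-box `B` and a compact `K`, `∫_{base} Σ_{w ∈ fibre z, (z,w) ∈ K} |slope Z (z,w)|² dz < ∞`:
cover `Z ∩ K` by finitely many windows of `w`-boxes and apply
`lintegral_sum_fibre_slopeSq_le`. [cite: Chirka1989, §14.1] -/
theorem lintegral_fibre_slopeSq_lt_top (hZ : BiWeierstrass Z) {K : Set (ℂ × ℂ)} (hK : IsCompact K) :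
    ∫⁻ z in B.base, ∑ w ∈ B.fibre z, K.indicator (slopeSq Z) (z, w) < ∞ := by
  classical
  -- co-boxes at the points of `Z ∩ K`
  have hex : ∀ q : ↥(Z ∩ K), ∃ B' : ZBox (Prod.swap ⁻¹' Z), B'.z₀ = q.1.2 ∧ B'.c = q.1.1 := by
    rintro ⟨q, hqZ, -⟩
    obtain ⟨B', h1, h2, -⟩ := (hZ.coWeierstrassAt q hqZ).exists_zbox (V := univ) univ_mem
    exact ⟨B', h1, h2⟩
  choose Bx hBz hBc using hex
  set N : ↥(Z ∩ K) → Set (ℂ × ℂ) := fun x => ball (Bx x).c (Bx x).r ×ˢ (Bx x).base with hN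
  have hNo : ∀ x, IsOpen (N x) := fun x => isOpen_ball.prod isOpen_ball
  have hcov : Z ∩ K ⊆ ⋃ x, N x := by
    intro q hq
    refine mem_iUnion.2 ⟨⟨q, hq⟩, ?_⟩
    refine mem_prod.2 ⟨?_, ?_⟩
    · rw [hBc]; exact mem_ball_self (Bx ⟨q, hq⟩).data.pos
    · change q.2 ∈ ball (Bx ⟨q, hq⟩).z₀ (Bx ⟨q, hq⟩).ε
      rw [hBz]; exact mem_ball_self (Bx ⟨q, hq⟩).ε_pos
  obtain ⟨t, ht⟩ := (hK.inter_left hZ.isClosed).elim_finite_subcover N hNo hcov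
  -- pointwise: the `K`-indicator is dominated by the sum of the window indicators, on `Z`
  have hpt : ∀ z ∈ B.base, ∑ w ∈ B.fibre z, K.indicator (slopeSq Z) (z, w) ≤
      ∑ x ∈ t, ∑ w ∈ B.fibre z, (N x).indicator (slopeSq Z) (z, w) := by
    intro z hz
    rw [Finset.sum_comm]
    refine Finset.sum_le_sum fun w hw => ?_
    by_cases hqK : (z, w) ∈ K
    · have hqZ : (z, w) ∈ Z := ((B.mem_fibre_iff hz).1 hw).2
      obtain ⟨x, hxt, hqx⟩ := mem_iUnion₂.1 (ht ⟨hqZ, hqK⟩)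
      rw [indicator_of_mem hqK]
      refine le_trans ?_ (Finset.single_le_sum (fun x _ => zero_le) hxt)
      rw [indicator_of_mem hqx]
    · rw [indicator_of_notMem hqK]
      exact zero_le
  calc ∫⁻ z in B.base, ∑ w ∈ B.fibre z, K.indicator (slopeSq Z) (z, w)
      ≤ ∫⁻ z in B.base, ∑ x ∈ t, ∑ w ∈ B.fibre z, (N x).indicator (slopeSq Z) (z, w) :=
        setLIntegral_mono' measurableSet_ball hpt
    _ = ∑ x ∈ t, ∫⁻ z in B.base, ∑ w ∈ B.fibre z, (N x).indicator (slopeSq Z) (z, w) :=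
        lintegral_finsetSum' _ fun x _ => B.aemeasurable_sum_fibre_slopeSq (hNo x)
    _ < ∞ := by
        refine ENNReal.sum_lt_top.2 fun x _ => ?_
        refine lt_of_le_of_lt (B.lintegral_sum_fibre_slopeSq_le (Bx x)) ?_
        exact ENNReal.mul_lt_top (ENNReal.natCast_lt_top _) measure_ball_lt_top

/-! ### Integrability of sheet sums -/

section Integrable

variable {F : Type*} [NormedAddCommGroup F] {g : ℂ × ℂ → ℂ → F}

/-- **A.e.-strong measurability of fibre sums of continuous integrands** on the base disc: on
each piece of the atlas the fibre sum is the restriction of a function continuous on the sheet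
disc. [folklore] -/
theorem aestronglyMeasurable_sum_fibre {M : Type*} [TopologicalSpace M]
    [TopologicalSpace.PseudoMetrizableSpace M] [AddCommMonoid M] [ContinuousAdd M]
    (φ : ℂ × ℂ → ℂ → M) (hφ : Continuous (Function.uncurry φ)) :
    AEStronglyMeasurable (fun z => ∑ w ∈ B.fibre z, φ (z, w) (slope Z (z, w)))
      (volume.restrict B.base) := by
  set A := B.atlas
  rw [A.restrict_base_eq, aestronglyMeasurable_iUnion_iff]
  intro n
  have hcont : ContinuousOn (fun z => ∑ i, φ (z, (A.S n).β i z) (deriv ((A.S n).β i) z)) (A.D n) := by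
    refine continuousOn_finsetSum _ fun i _ => ?_
    have hβ : ContinuousOn ((A.S n).β i) (A.D n) := ((A.S n).differentiableOn i).continuousOn
    have hβ' : ContinuousOn (deriv ((A.S n).β i)) (A.D n) :=
      (((A.S n).differentiableOn i).analyticOnNhd isOpen_ball).deriv.continuousOn
    exact hφ.comp_continuousOn ((continuousOn_id.prodMk hβ).prodMk hβ')
  have h1 : AEStronglyMeasurable (fun z => ∑ i, φ (z, (A.S n).β i z) (deriv ((A.S n).β i) z))
      (volume.restrict (A.Q n)) :=
    (hcont.aestronglyMeasurable (A.isOpen_D n).measurableSet).mono_measure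
      (Measure.restrict_mono (A.Q_subset_D n) le_rfl)
  refine h1.congr ?_
  rw [EventuallyEq, ae_restrict_iff' (A.measurableSet_Q n)]
  refine Eventually.of_forall fun z hz => ?_
  rw [A.sum_fibre_eq hz]
  exact Finset.sum_congr rfl fun i _ => by rw [A.slope_eq hz i]

/-- Pointwise bound of a sheet sum by the slope density (quadratic growth). [folklore] -/
theorem enorm_sheetSum_le (hg : SuppIn g B.box) {U : Set (ℂ × ℂ)} (hgU : SuppIn g U) {C : ℝ}
    (hC0 : 0 ≤ C) (hC : ∀ q σ, ‖g q σ‖ ≤ C * (1 + ‖σ‖ ^ 2)) {z : ℂ} (hz : z ∈ B.base) :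
    ‖sheetSum Z g z‖ₑ ≤ ENNReal.ofReal C *
      (B.deg + ∑ w ∈ B.fibre z, U.indicator (slopeSq Z) (z, w)) := by
  rw [B.sheetSum_eq_sum_fibre hg hz]
  refine (enorm_sum_le _ _).trans ?_
  have hterm : ∀ w ∈ B.fibre z, ‖g (z, w) (slope Z (z, w))‖ₑ ≤
      ENNReal.ofReal C * (U.indicator (fun _ => (1 : ℝ≥0∞)) (z, w) + U.indicator (slopeSq Z) (z, w)) := by
    intro w _
    by_cases hU : (z, w) ∈ U
    · rw [indicator_of_mem hU, indicator_of_mem hU, slopeSq, ← ofReal_norm,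
        ← ENNReal.ofReal_one, ← ENNReal.ofReal_add zero_le_one (by positivity),
        ← ENNReal.ofReal_mul hC0]
      exact ENNReal.ofReal_le_ofReal (hC _ _)
    · rw [hgU _ hU, enorm_zero]
      exact zero_le
  refine (Finset.sum_le_sum hterm).trans ?_
  rw [← Finset.mul_sum, Finset.sum_add_distrib]
  gcongr
  calc ∑ w ∈ B.fibre z, U.indicator (fun _ => (1 : ℝ≥0∞)) (z, w) ≤ ∑ _w ∈ B.fibre z, (1 : ℝ≥0∞) :=
        Finset.sum_le_sum fun w _ => Set.indicator_le (fun _ _ => le_rfl) _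
    _ = (B.fibre z).card := by simp
    _ ≤ B.deg := by exact_mod_cast B.card_fibre_le hz

/-- **Integrability of sheet sums** of box-supported, compactly supported, continuous integrands
of at most quadratic growth in the slope (Lelong's area bound). [cite: Chirka1989, §14.1] -/
theorem integrable_sheetSum (hZ : BiWeierstrass Z) (hg : SuppIn g B.box) {K : Set (ℂ × ℂ)}
    (hK : IsCompact K) (hgK : SuppIn g K) (hgc : Continuous (Function.uncurry g)) {C : ℝ}
    (hC0 : 0 ≤ C) (hC : ∀ q σ, ‖g q σ‖ ≤ C * (1 + ‖σ‖ ^ 2)) : Integrable (sheetSum Z g) volume := by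
  refine ⟨B.aestronglyMeasurable_sheetSum hg hgc, ?_⟩
  -- an open neighbourhood `U` of `K` with compact closure
  set U : Set (ℂ × ℂ) := Metric.thickening 1 K with hU
  have hUo : IsOpen U := Metric.isOpen_thickening
  have hKU : K ⊆ U := Metric.self_subset_thickening one_pos K
  have hUK' : U ⊆ Metric.cthickening 1 K := Metric.thickening_subset_cthickening 1 K
  have hK' : IsCompact (Metric.cthickening 1 K) := hK.cthickening
  have hgU : SuppIn g U := hgK.mono hKU
  -- the integral over the complement of the base disc vanishes
  have hzero : ∀ z ∉ B.base, sheetSum Z g z = 0 := fun z hz => B.sheetSum_eq_zero hg hz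
  rw [hasFiniteIntegral_iff_enorm, ← lintegral_add_compl _ (measurableSet_ball : MeasurableSet B.base)]
  have hcompl : ∫⁻ z in B.baseᶜ, ‖sheetSum Z g z‖ₑ = 0 := by
    refine (setLIntegral_congr_fun measurableSet_ball.compl fun z hz => ?_).trans lintegral_zero
    rw [hzero z hz, enorm_zero]
  rw [hcompl, add_zero]
  -- bound on the base disc by the local area bound
  have hmeas := B.aemeasurable_sum_fibre_slopeSq hUo
  calc ∫⁻ z in B.base, ‖sheetSum Z g z‖ₑ
      ≤ ∫⁻ z in B.base, ENNReal.ofReal C *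
          (B.deg + ∑ w ∈ B.fibre z, U.indicator (slopeSq Z) (z, w)) :=
        setLIntegral_mono' measurableSet_ball fun z hz => B.enorm_sheetSum_le hg hgU hC0 hC hz
    _ = ENNReal.ofReal C * ((B.deg : ℝ≥0∞) * volume B.base +
          ∫⁻ z in B.base, ∑ w ∈ B.fibre z, U.indicator (slopeSq Z) (z, w)) := by
        rw [lintegral_const_mul'' _ (hmeas.const_add _), lintegral_add_left' aemeasurable_const,
          lintegral_const, Measure.restrict_apply_univ]
    _ < ∞ := by
        refine ENNReal.mul_lt_top ENNReal.ofReal_lt_top (ENNReal.add_lt_top.2 ⟨?_, ?_⟩)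
        · exact ENNReal.mul_lt_top (ENNReal.natCast_lt_top _) measure_ball_lt_top
        · refine lt_of_le_of_lt (lintegral_mono fun z => ?_) (B.lintegral_fibre_slopeSq_lt_top hZ hK')
          exact Finset.sum_le_sum fun w _ =>
            indicator_le_indicator_of_subset hUK' (fun _ => zero_le) _

/-- Pointwise bound of the square of a sheet sum by the slope density (linear growth;
Cauchy–Schwarz over the at most `deg` fibre points). [folklore] -/
theorem ofReal_norm_sheetSum_sq_le (hg : SuppIn g B.box) {U : Set (ℂ × ℂ)} (hgU : SuppIn g U)
    {C : ℝ} (hC0 : 0 ≤ C) (hC : ∀ q σ, ‖g q σ‖ ≤ C * (1 + ‖σ‖)) {z : ℂ} (hz : z ∈ B.base) :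
    ENNReal.ofReal (‖sheetSum Z g z‖ ^ 2) ≤ ENNReal.ofReal (2 * C ^ 2 * B.deg) *
      (B.deg + ∑ w ∈ B.fibre z, U.indicator (slopeSq Z) (z, w)) := by
  classical
  rw [B.sheetSum_eq_sum_fibre hg hz]
  set a : ℂ → ℝ := fun w => U.indicator (fun q => C * (1 + ‖slope Z q‖)) (z, w) with ha
  have ha0 : ∀ w, 0 ≤ a w := fun w => Set.indicator_nonneg (fun _ _ => by positivity) _
  have hnorm : ‖∑ w ∈ B.fibre z, g (z, w) (slope Z (z, w))‖ ≤ ∑ w ∈ B.fibre z, a w := by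
    refine (norm_sum_le _ _).trans (Finset.sum_le_sum fun w _ => ?_)
    by_cases hU : (z, w) ∈ U
    · change ‖g (z, w) (slope Z (z, w))‖ ≤ U.indicator (fun q => C * (1 + ‖slope Z q‖)) (z, w)
      rw [indicator_of_mem hU]; exact hC _ _
    · rw [hgU _ hU, norm_zero]; exact ha0 w
  -- Cauchy–Schwarz and `(1 + x)² ≤ 2 (1 + x²)`
  have hsq : ‖∑ w ∈ B.fibre z, g (z, w) (slope Z (z, w))‖ ^ 2 ≤
      2 * C ^ 2 * B.deg * ((B.deg : ℝ) + ∑ w ∈ B.fibre z, U.indicator (fun q => ‖slope Z q‖ ^ 2) (z, w)) := by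
    have h1 : ‖∑ w ∈ B.fibre z, g (z, w) (slope Z (z, w))‖ ^ 2 ≤ (∑ w ∈ B.fibre z, a w) ^ 2 :=
      pow_le_pow_left₀ (norm_nonneg _) hnorm 2
    have h2 : (∑ w ∈ B.fibre z, a w) ^ 2 ≤ (B.fibre z).card * ∑ w ∈ B.fibre z, a w ^ 2 :=
      sq_sum_le_card_mul_sum_sq
    have h3 : ∀ w ∈ B.fibre z, a w ^ 2 ≤
        2 * C ^ 2 * (U.indicator (fun _ => (1 : ℝ)) (z, w) + U.indicator (fun q => ‖slope Z q‖ ^ 2) (z, w)) := by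
      intro w _
      by_cases hU : (z, w) ∈ U
      · simp only [ha, indicator_of_mem hU]
        nlinarith [sq_nonneg (1 - ‖slope Z (z, w)‖), sq_nonneg C, norm_nonneg (slope Z (z, w))]
      · simp only [ha, indicator_of_notMem hU]
        simp
    have hcard : ((B.fibre z).card : ℝ) ≤ B.deg := by exact_mod_cast B.card_fibre_le hz
    have hind1 : ∑ w ∈ B.fibre z, U.indicator (fun _ => (1 : ℝ)) (z, w) ≤ B.deg :=
      le_trans (Finset.sum_le_sum fun w _ => Set.indicator_le_self' (fun _ _ => zero_le_one) _)
        (by simpa using hcard)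
    have hS0 : 0 ≤ ∑ w ∈ B.fibre z, U.indicator (fun q => ‖slope Z q‖ ^ 2) (z, w) :=
      Finset.sum_nonneg fun w _ => Set.indicator_nonneg (fun _ _ => by positivity) _
    have hA0 : 0 ≤ ∑ w ∈ B.fibre z, a w ^ 2 := Finset.sum_nonneg fun w _ => by positivity
    calc ‖∑ w ∈ B.fibre z, g (z, w) (slope Z (z, w))‖ ^ 2
        ≤ (B.fibre z).card * ∑ w ∈ B.fibre z, a w ^ 2 := h1.trans h2
      _ ≤ B.deg * ∑ w ∈ B.fibre z, a w ^ 2 := by gcongr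
      _ ≤ B.deg * ∑ w ∈ B.fibre z, 2 * C ^ 2 *
            (U.indicator (fun _ => (1 : ℝ)) (z, w) + U.indicator (fun q => ‖slope Z q‖ ^ 2) (z, w)) := by
          gcongr with w hw
          exact h3 w hw
      _ = 2 * C ^ 2 * B.deg * (∑ w ∈ B.fibre z, U.indicator (fun _ => (1 : ℝ)) (z, w) +
            ∑ w ∈ B.fibre z, U.indicator (fun q => ‖slope Z q‖ ^ 2) (z, w)) := by
          rw [← Finset.mul_sum, Finset.sum_add_distrib]; ring
      _ ≤ 2 * C ^ 2 * B.deg * ((B.deg : ℝ) + ∑ w ∈ B.fibre z, U.indicator (fun q => ‖slope Z q‖ ^ 2) (z, w)) := by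
          gcongr
  -- pass to `ℝ≥0∞`
  refine (ENNReal.ofReal_le_ofReal hsq).trans (le_of_eq ?_)
  have hS0 : 0 ≤ ∑ w ∈ B.fibre z, U.indicator (fun q => ‖slope Z q‖ ^ 2) (z, w) :=
    Finset.sum_nonneg fun w _ => Set.indicator_nonneg (fun _ _ => by positivity) _
  rw [ENNReal.ofReal_mul (by positivity), ENNReal.ofReal_add (by positivity) hS0,
    ENNReal.ofReal_natCast, ENNReal.ofReal_sum_of_nonneg
      (fun w _ => Set.indicator_nonneg (fun _ _ => by positivity) _)]
  congr 2
  refine Finset.sum_congr rfl fun w _ => ?_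
  by_cases hU : (z, w) ∈ U
  · rw [indicator_of_mem hU, indicator_of_mem hU, slopeSq]
  · rw [indicator_of_notMem hU, indicator_of_notMem hU, ENNReal.ofReal_zero]

/-- **Square-integrability of sheet sums** of box-supported, compactly supported, continuous
integrands of at most linear growth in the slope (Lelong's area bound). [cite: Chirka1989, §14.1] -/
theorem integrable_norm_sheetSum_sq (hZ : BiWeierstrass Z) (hg : SuppIn g B.box)
    {K : Set (ℂ × ℂ)} (hK : IsCompact K) (hgK : SuppIn g K) (hgc : Continuous (Function.uncurry g))
    {C : ℝ} (hC0 : 0 ≤ C) (hC : ∀ q σ, ‖g q σ‖ ≤ C * (1 + ‖σ‖)) :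
    Integrable (fun z => ‖sheetSum Z g z‖ ^ 2) volume := by
  refine ⟨((B.aestronglyMeasurable_sheetSum hg hgc).norm.aemeasurable.pow_const 2).aestronglyMeasurable, ?_⟩
  set U : Set (ℂ × ℂ) := Metric.thickening 1 K with hU
  have hUo : IsOpen U := Metric.isOpen_thickening
  have hKU : K ⊆ U := Metric.self_subset_thickening one_pos K
  have hUK' : U ⊆ Metric.cthickening 1 K := Metric.thickening_subset_cthickening 1 K
  have hK' : IsCompact (Metric.cthickening 1 K) := hK.cthickening
  have hgU : SuppIn g U := hgK.mono hKU
  have hzero : ∀ z ∉ B.base, sheetSum Z g z = 0 := fun z hz => B.sheetSum_eq_zero hg hz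
  rw [hasFiniteIntegral_iff_enorm, ← lintegral_add_compl _ (measurableSet_ball : MeasurableSet B.base)]
  have hcompl : ∫⁻ z in B.baseᶜ, ‖‖sheetSum Z g z‖ ^ 2‖ₑ = 0 := by
    refine (setLIntegral_congr_fun measurableSet_ball.compl fun z hz => ?_).trans lintegral_zero
    rw [hzero z hz, norm_zero, zero_pow two_ne_zero, enorm_zero]
  rw [hcompl, add_zero]
  have hmeas := B.aemeasurable_sum_fibre_slopeSq hUo
  have henorm : ∀ z, ‖‖sheetSum Z g z‖ ^ 2‖ₑ = ENNReal.ofReal (‖sheetSum Z g z‖ ^ 2) := fun z => by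
    rw [Real.enorm_eq_ofReal (by positivity)]
  calc ∫⁻ z in B.base, ‖‖sheetSum Z g z‖ ^ 2‖ₑ
      ≤ ∫⁻ z in B.base, ENNReal.ofReal (2 * C ^ 2 * B.deg) *
          (B.deg + ∑ w ∈ B.fibre z, U.indicator (slopeSq Z) (z, w)) :=
        setLIntegral_mono' measurableSet_ball fun z hz => by
          rw [henorm]; exact B.ofReal_norm_sheetSum_sq_le hg hgU hC0 hC hz
    _ = ENNReal.ofReal (2 * C ^ 2 * B.deg) * ((B.deg : ℝ≥0∞) * volume B.base +
          ∫⁻ z in B.base, ∑ w ∈ B.fibre z, U.indicator (slopeSq Z) (z, w)) := by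
        rw [lintegral_const_mul'' _ (hmeas.const_add _), lintegral_add_left' aemeasurable_const,
          lintegral_const, Measure.restrict_apply_univ]
    _ < ∞ := by
        refine ENNReal.mul_lt_top ENNReal.ofReal_lt_top (ENNReal.add_lt_top.2 ⟨?_, ?_⟩)
        · exact ENNReal.mul_lt_top (ENNReal.natCast_lt_top _) measure_ball_lt_top
        · refine lt_of_le_of_lt (lintegral_mono fun z => ?_) (B.lintegral_fibre_slopeSq_lt_top hZ hK')
          exact Finset.sum_le_sum fun w _ =>
            indicator_le_indicator_of_subset hUK' (fun _ => zero_le) _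

end Integrable

end ZBox

end PlaneCurve

end Literature.Analysis.Complex
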